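import Literature.AlgebraicGeometry.HodgeTheory.HodgeStructureWeilJacobianDirectFactor
import Literature.AlgebraicGeometry.HodgeTheory.HodgeStructureIntermediateJacobianDirectSumPolarization
import HarnessLib

/-!
# Weil's Jacobian as a functor to POLARIZED tori; the factors of an integral splitting are polarized
# direct factors (Clemens–Griffiths Def. 3.5 «ℋ₁ = (ℋ₂)_α», Lemma 3.11 «(ℋ_C)_{φ_*} = ℋ_{V₁}|»)

Layer `Literature/AlgebraicGeometry/HodgeTheory`, namespace `Literature.AlgebraicGeometry.HodgeTheory`
(lane `lit-hodgefound`, Track 2 foundations library; prover seat `lit-hodgefound-p26`, gen 9, row g9-#6).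
Sequel of `HodgeStructureWeilJacobianDirectFactor.lean` (g9-#5: the factor maps of `J_W` through an integral
splitting are holomorphic) and `HodgeStructureIntermediateJacobianDirectSumPolarization.lean` (g9-#3: `ρ(1) :
J_W(H₁ ⊕ H₂) ≅ J_W(H₁) × J_W(H₂)` is an isomorphism of polarized abelian varieties). Here the POLARIZATIONS
are followed along arbitrary morphisms: for an injective morphism of Hodge structures `φ : H → H′` of odd weight
with integer matrix `A` in lattice bases and a polarization `Q` of `H′`, Lange's real form `A_{φ^*Q} = -(φ^*Q)_ℝ`
of the pulled-back polarization `φ^*Q` (`Polarization.comap`) on `Λ ⊗ ℝ` is `A_Q ∘ (A_ℝ × A_ℝ)`, so the analytic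
representation of `J_W(φ) = ρ(A)` PULLS the `2`-form `c·A_Q` of `J_W(H′, Λ′)` BACK to `c·A_{φ^*Q}` — `J_W(φ)` is
a morphism of polarized tori in the sense of Clemens–Griffiths Def. 3.5, and when `ρ(A)` is injective a Riemann
form `N·A_Q` pulls back to the Riemann form `N·A_{φ^*Q}`. Through an isomorphism of integral Hodge structures
`φ : H₀ ≅ H₁ ⊕ H₂` with `H₀` polarized by `Q₀ = φ^*(Q₁ ⊕ Q₂)`, the inclusions `ρ(B(1;0))`, `ρ(B(0;1))` of the
factors pull `N·A_{Q₀}` back to `N·A_{Q₁}`, `N·A_{Q₂}` for ONE `N`: the `J_W(Hᵢ, Λᵢ)` with their own polarizations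
are polarized direct factors of `(J_W(H₀, Λ₀), N·A_{Q₀})` — "`𝒥(V₁) ≅ 𝒥(V₂) ⊕ 𝒥(C)`", including the twisted
summand `L(r)` (blow-up: `J(C)` inside `J_W(H³(X̃))` with "`(ℋ_C)_{φ_*} = ℋ_{V₁}` restricted").

## Sources, verbatim

* C. H. Clemens, P. A. Griffiths, Ann. of Math. 95 (1972) [held `paper:doi-10-2307-1970801`], §3 p. 293, Def. 3.5:
  "a morphism of polarized tori `(W₁, U₁, ℋ₁) → (W₂, U₂, ℋ₂)` means a linear transformation `α : W₁ → W₂` such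
  that `α(U₁) ⊆ U₂` and `ℋ₁ = (ℋ₂)_α` (the pullback of `ℋ₂` under `α`)"; (3.6) the direct sum of polarized
  tori; p. 294, Lemma 3.11 "`𝒥(V₁) ≅ 𝒥(V₂) ⊕ 𝒥(C)`", proof: "(ii) `(ℋ_C)_{φ_*} = ℋ_{V₁}|_{φ_*(…)}` […] `φ_*`
  commutes with the Hodge decompositions".
* C. Voisin, *Hodge Theory and Complex Algebraic Geometry I* (2002), §7.1.2 Def. 7.7 and §7.3.1 (a sub-Hodge
  structure of a polarized Hodge structure is polarized by the restricted form), Ch. 12 Exercise 1 (a) (p0258).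
* H. Lange, *Abelian Varieties over the Complex Numbers* (2023), §5.4.1 (5.24) (`A = -Q_ℝ`), §5.4.3 Prop. 5.4.11,
  §2.1.1 Cor. 2.1.4 (restriction of a polarization to an abelian subvariety), §1.1.2 Prop. 1.1.6.

## What is proved (no `def`, no named fact)

* §1 **`J_W` on polarized objects** (any injective `φ : H.Hom H′`, `toMatrix b b′ φ = A`, `Q : H′.Polarization`):
  `Polarization.weilCoordForm_congr` (equal forms ⇒ equal `A`), **`Hom.weilCoordForm_comap`**
  (`A_{φ^*Q}(x, y) = A_Q(A x, A y)`), `Hom.weilTwoForm_comap_apply`,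
  **`Hom.pullbackForm_analyticRep_weilTwoForm`** (`ρ(A)^*(c·A_Q) = c·A_{φ^*Q}`: C–G Def. 3.5),
  **`Hom.isRiemannForm_smul_weilTwoForm_comap`** (`ρ(A)` injective, `c·A_Q` Riemann ⇒ `c·A_{φ^*Q}` Riemann).
* §2 **through a splitting `φ : H₀ ≅ H₁ ⊕ H₂`** (`B A = 1`, `A B = 1`; `Q₀ = φ^*(Q₁ ⊕ Q₂)`):
  `Hom.toLinearMap_injective_of_inverse`; `weilCoordForm_comap_prod_factorInl/Inr`
  (`A_{Q₀}(B(1;0)x, B(1;0)y) = A_{Q₁}(x, y)`); the analytic representations of the factor inclusions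
  (`Hom.map_intCast_factorInl/Inr_mul_jMatrix_weilMinusCPeriod`); **`pullbackForm_analyticRep_factorInl_weilTwoForm`**,
  **`…factorInr…`** (`ρ(B(1;0))^*(c·A_{Q₀}) = c·A_{Q₁}`, `ρ(B(0;1))^*(c·A_{Q₀}) = c·A_{Q₂}`);
  **`clemensGriffiths_3_11_weilJacobian`**: ONE `N ≥ 1` with `N·A_{Q₀}`, `N·A_{Q₁}`, `N·A_{Q₂}` Riemann forms of
  `J_W(H₀)`, `J_W(H₁)`, `J_W(H₂)` and both pullback identities — the factors are polarized direct factors.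
* §3 **the twisted summand**: `((Q_L.tateTwist r).cast hk)` has the same `A` (`weilCoordForm_tateTwist_cast`);
  `Hom.map_intCast_twistedFactorInr_mul_jMatrix_weilMinusCPeriod`; **`pullbackForm_analyticRep_twistedFactorInr_weilTwoForm`**
  (`ρ(B(0;1))^*(c·A_{Q′}) = c·A_{Q_L}` on `J_W(L, Λ_L)`, `Q′ = φ^*(Q_H ⊕ Q_L(r))`);
  **`clemensGriffiths_3_11_weilJacobian_twisted`**; §4 the blow-up numerology `(3, 1, -1)`:
  **`clemensGriffiths_3_11_weilJacobian_blowup`** (`J_W(H¹(C))` with `N·A_{Q_C}` is a polarized direct factor of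
  `(J_W(H³(X̃)), N·A_{Q′})`).

## References

* [ClemensGriffiths1972] C. H. Clemens, P. A. Griffiths, The intermediate Jacobian of the cubic threefold,
  Ann. of Math. (2) 95 (1972), §3 Def. 3.5, (3.6), (3.10), Lemma 3.11 and proof (pp. 293–294).
* [VoisinHodgeI2002] C. Voisin, Hodge Theory and Complex Algebraic Geometry I, CUP 2002, §7.1.2 Def. 7.7, §7.3.1,
  Ch. 12 Exercise 1 (a) (PDF p. 258).
* [Lange2023AbelianVarietiesComplex] H. Lange, Abelian Varieties over the Complex Numbers, Springer 2023,
  §5.4.1 (5.24), §5.4.3 Prop. 5.4.11, §2.1.1 Cor. 2.1.4, §1.1.2 Prop. 1.1.6.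
-/

open scoped TensorProduct Manifold ContDiff Matrix
open Module
open Literature.AlgebraicGeometry.Motives
open Literature.AlgebraicGeometry.Motives.HodgeStructure
open Literature.Geometry.Kaehler
open Literature.Geometry.Kaehler.ComplexTorus

noncomputable section

universe u v w

namespace Literature.AlgebraicGeometry.HodgeTheory

variable {V : Type u} [AddCommGroup V] [Module ℚ V] {W : Type v} [AddCommGroup W] [Module ℚ W]
  {V₀ : Type w} [AddCommGroup V₀] [Module ℚ V₀]

/-! ## §0 Plumbing -/

section Plumbing

/-- Base change to `ℝ` of a composite bilinear form: `(B ∘ (f × f))_ℝ (a, c) = B_ℝ (f_ℝ a, f_ℝ c)`. Private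
plumbing (real twin of `HodgeStructure.baseChange_compl₁₂`). [folklore] -/
private theorem wP_baseChange_real_compl₁₂ (B : LinearMap.BilinForm ℚ V) (f : V₀ →ₗ[ℚ] V) (a c : ℝ ⊗[ℚ] V₀) :
    LinearMap.BilinForm.baseChange ℝ (B.compl₁₂ f f) a c = B.baseChange ℝ (f.baseChange ℝ a) (f.baseChange ℝ c) := by
  induction a using TensorProduct.induction_on with
  | zero => rw [map_zero, map_zero, LinearMap.zero_apply, map_zero, LinearMap.zero_apply]
  | tmul r v =>
    induction c using TensorProduct.induction_on with
    | zero => rw [map_zero, map_zero, map_zero]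
    | tmul s w =>
      rw [LinearMap.BilinForm.baseChange_tmul, LinearMap.baseChange_tmul, LinearMap.baseChange_tmul,
        LinearMap.BilinForm.baseChange_tmul, LinearMap.compl₁₂_apply]
    | add y₁ y₂ h₁ h₂ => rw [map_add, map_add, map_add, h₁, h₂]
  | add x₁ x₂ h₁ h₂ =>
    rw [map_add, map_add, LinearMap.add_apply, map_add, LinearMap.add_apply, h₁, h₂]

/-- A pair `v : Fin 2 → E` is `![v 0, v 1]`. Private plumbing. [folklore] -/
private theorem wP_eq_vecCons_two {E : Type*} (v : Fin 2 → E) : v = ![v 0, v 1] := by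
  ext i
  fin_cases i <;> rfl

/-- `ℤ → ℝ` is multiplicative on matrices. Private plumbing. [folklore] -/
private theorem wP_map_intCast_mul {α β γ : Type*} [Fintype β] (M : Matrix α β ℤ) (N : Matrix β γ ℤ) :
    (M * N).map (Int.cast : ℤ → ℝ) = M.map (Int.cast : ℤ → ℝ) * N.map (Int.cast : ℤ → ℝ) := by
  ext i j
  simp [Matrix.mul_apply]

/-- `ℤ → ℚ` is multiplicative on matrices. Private plumbing. [folklore] -/
private theorem wP_map_intCast_mul_rat {α β γ : Type*} [Fintype β] (M : Matrix α β ℤ) (N : Matrix β γ ℤ) :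
    (M * N).map (Int.cast : ℤ → ℚ) = M.map (Int.cast : ℤ → ℚ) * N.map (Int.cast : ℤ → ℚ) := by
  ext i j
  simp [Matrix.mul_apply]

/-- `(1; 0)_ℝ x = (x, 0)` in sum coordinates. Private plumbing. [folklore] -/
private theorem wP_fromRows_one_zero_mulVec {ι₁ ι₂ : Type*} [Fintype ι₁] [DecidableEq ι₁] (x : ι₁ → ℝ) :
    (Matrix.fromRows (1 : Matrix ι₁ ι₁ ℤ) (0 : Matrix ι₂ ι₁ ℤ)).map (Int.cast : ℤ → ℝ) *ᵥ x = Sum.elim x (0 : ι₂ → ℝ) := by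
  have h : (Matrix.fromRows (1 : Matrix ι₁ ι₁ ℤ) (0 : Matrix ι₂ ι₁ ℤ)).map (Int.cast : ℤ → ℝ) =
      Matrix.fromRows (1 : Matrix ι₁ ι₁ ℝ) (0 : Matrix ι₂ ι₁ ℝ) := by
    ext (i | i) j
    · simp [Matrix.fromRows, Matrix.one_apply]
    · simp [Matrix.fromRows]
  rw [h, Matrix.fromRows_mulVec, Matrix.one_mulVec, Matrix.zero_mulVec]

/-- `(0; 1)_ℝ y = (0, y)` in sum coordinates. Private plumbing. [folklore] -/
private theorem wP_fromRows_zero_one_mulVec {ι₁ ι₂ : Type*} [Fintype ι₂] [DecidableEq ι₂] (y : ι₂ → ℝ) :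
    (Matrix.fromRows (0 : Matrix ι₁ ι₂ ℤ) (1 : Matrix ι₂ ι₂ ℤ)).map (Int.cast : ℤ → ℝ) *ᵥ y = Sum.elim (0 : ι₁ → ℝ) y := by
  have h : (Matrix.fromRows (0 : Matrix ι₁ ι₂ ℤ) (1 : Matrix ι₂ ι₂ ℤ)).map (Int.cast : ℤ → ℝ) =
      Matrix.fromRows (0 : Matrix ι₁ ι₂ ℝ) (1 : Matrix ι₂ ι₂ ℝ) := by
    ext (i | i) j
    · simp [Matrix.fromRows]
    · simp [Matrix.fromRows, Matrix.one_apply]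
  rw [h, Matrix.fromRows_mulVec, Matrix.one_mulVec, Matrix.zero_mulVec]

end Plumbing

/-! ## §1 `J_W` is a functor to polarized tori: `ρ(A)^*(c·A_Q) = c·A_{φ^*Q}` -/

section Functor

variable {V' : Type v} [AddCommGroup V'] [Module ℚ V'] {n : ℤ} (H : HodgeStructure V n)
  (H' : HodgeStructure V' n) (hn : Odd n) [Module.Finite ℚ V] [Module.Finite ℚ V'] {ι ι' : Type*} [Fintype ι]
  [Fintype ι'] [DecidableEq ι] [DecidableEq ι'] (b : Basis ι ℚ V) (b' : Basis ι' ℚ V') {A : Matrix ι' ι ℤ}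

omit [Module.Finite ℚ V] [DecidableEq ι] in
/-- Polarizations with the same form have the same real form `A = -Q_ℝ` in lattice coordinates (Lange's `A`
depends on `Q` only through its form). [cite: Lange2023AbelianVarietiesComplex, §5.4.1 (5.24)] -/
theorem _root_.Literature.AlgebraicGeometry.Motives.HodgeStructure.Polarization.weilCoordForm_congr
    {m : ℤ} {H₁ : HodgeStructure V n} {H₂ : HodgeStructure V m} (Q₁ : H₁.Polarization) (Q₂ : H₂.Polarization)
    (h : Q₁.form = Q₂.form) : Q₁.weilCoordForm b = Q₂.weilCoordForm b := by
  refine LinearMap.ext fun x ↦ LinearMap.ext fun y ↦ ?_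
  rw [Polarization.weilCoordForm_apply, Polarization.weilCoordForm_apply, h]

omit [Module.Finite ℚ V] [Module.Finite ℚ V'] [DecidableEq ι'] in
/-- **`A_{φ^*Q}(x, y) = A_Q(A x, A y)`**: Lange's real form of the pulled-back polarization `φ^*Q`
(`Polarization.comap`) in the coordinates of `Λ` is that of `Q` composed with `A_ℝ`, `A` the integer matrix of
`φ` ("`ℋ₁ = (ℋ₂)_α`, the pullback of `ℋ₂` under `α`"). [cite: ClemensGriffiths1972, §3 Def. 3.5 (p. 293)]
[cite: Lange2023AbelianVarietiesComplex, §5.4.1 (5.24)] -/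
theorem _root_.Literature.AlgebraicGeometry.Motives.HodgeStructure.Hom.weilCoordForm_comap (φ : H.Hom H')
    (hφ : Function.Injective φ.toLinearMap) (hA : LinearMap.toMatrix b b' φ.toLinearMap = A.map (Int.cast : ℤ → ℚ))
    (Q : H'.Polarization) (x y : ι → ℝ) :
    (Q.comap φ hφ).weilCoordForm b x y =
      Q.weilCoordForm b' (A.map (Int.cast : ℤ → ℝ) *ᵥ x) (A.map (Int.cast : ℤ → ℝ) *ᵥ y) := by
  have hform : (Q.comap φ hφ).form = Q.form.compl₁₂ φ.toLinearMap φ.toLinearMap := rfl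
  rw [Polarization.weilCoordForm_apply, Polarization.weilCoordForm_apply, hform, wP_baseChange_real_compl₁₂,
    φ.baseChange_equivFun_symm H H' b b' hA, φ.baseChange_equivFun_symm H H' b b' hA]

omit [DecidableEq ι'] in
/-- The same on the tori's covering spaces: `A_{φ^*Q}` at the period images `Ψ x`, `Ψ y` of `J_W(H, Λ)` is `A_Q`
at the period images `Ψ′(A x)`, `Ψ′(A y)` of `J_W(H′, Λ′)`. [cite: ClemensGriffiths1972, §3 Def. 3.5 (p. 293)]
[cite: Lange2023AbelianVarietiesComplex, §5.4.3 Prop. 5.4.11] -/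
theorem _root_.Literature.AlgebraicGeometry.Motives.HodgeStructure.Hom.weilTwoForm_comap_apply (φ : H.Hom H')
    (hφ : Function.Injective φ.toLinearMap) (hA : LinearMap.toMatrix b b' φ.toLinearMap = A.map (Int.cast : ℤ → ℚ))
    (Q : H'.Polarization) (x y : ι → ℝ) :
    (Q.comap φ hφ).weilTwoForm b hn ![weilMinusCPeriod H hn b x, weilMinusCPeriod H hn b y] =
      Q.weilTwoForm b' hn
        ![weilMinusCPeriod H' hn b' (A.map (Int.cast : ℤ → ℝ) *ᵥ x),
          weilMinusCPeriod H' hn b' (A.map (Int.cast : ℤ → ℝ) *ᵥ y)] := by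
  rw [Polarization.weilTwoForm_apply_apply, Polarization.weilTwoForm_apply_apply,
    φ.weilCoordForm_comap H H' b b' hφ hA Q]

/-- **`J_W(φ)` is a morphism of polarized tori (Clemens–Griffiths Def. 3.5: `ℋ₁ = (ℋ₂)_α`)**: for an injective
morphism of Hodge structures `φ : H → H′` of odd weight with integer matrix `A` (`φ(Λ) ⊆ Λ′`) and a polarization
`Q` of `H′`, the analytic representation of `J_W(φ) = ρ(A) : J_W(H, Λ) → J_W(H′, Λ′)` PULLS every real multiple
`c·A_Q` of Lange's `2`-form of `Q` BACK to `c·A_{φ^*Q}`, the `2`-form of the pulled-back polarization `φ^*Q`.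
[cite: ClemensGriffiths1972, §3 Def. 3.5 (p. 293)] [cite: Lange2023AbelianVarietiesComplex, §5.4.3 Prop. 5.4.11, §1.1.2 Prop. 1.1.6] -/
theorem _root_.Literature.AlgebraicGeometry.Motives.HodgeStructure.Hom.pullbackForm_analyticRep_weilTwoForm
    (φ : H.Hom H') (hφ : Function.Injective φ.toLinearMap)
    (hA : LinearMap.toMatrix b b' φ.toLinearMap = A.map (Int.cast : ℤ → ℚ)) (Q : H'.Polarization) (c : ℝ) :
    pullbackForm
        (analyticRep (weilMinusCPeriod H hn b) (weilMinusCPeriod H' hn b') (A.map (Int.cast : ℤ → ℝ))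
          (φ.map_intCast_mul_jMatrix_weilMinusCPeriod H H' hn b b' hA))
        (c • Q.weilTwoForm b' hn) =
      c • (Q.comap φ hφ).weilTwoForm b hn := by
  ext v
  obtain ⟨x, hx⟩ := (weilMinusCPeriod H hn b).surjective (v 0)
  obtain ⟨y, hy⟩ := (weilMinusCPeriod H hn b).surjective (v 1)
  rw [wP_eq_vecCons_two v, ← hx, ← hy, pullbackForm_apply, analyticRep_apply, analyticRep_apply,
    ContinuousAlternatingMap.smul_apply, ContinuousAlternatingMap.smul_apply,
    φ.weilTwoForm_comap_apply H H' hn b b' hφ hA Q]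

-- `IsRiemannForm.pullback` / `analyticRep_injective_of_mapMatrix_injective` applied to the period isomorphisms
-- `weilMinusCPeriod` unify deeply nested coercions: raise the recursion limit (elaboration stays fast).
set_option maxRecDepth 8192 in
/-- **A Riemann form restricts to a Riemann form along an injective `J_W(φ)`**: if `ρ(A) : J_W(H, Λ) → J_W(H′, Λ′)`
is injective and `c·A_Q` is a Riemann form of `J_W(H′, Λ′)`, then `c·A_{φ^*Q} = ρ(A)^*(c·A_Q)` is a Riemann form
of `J_W(H, Λ)` (a sub-Hodge structure of a polarized Hodge structure is polarized by the restricted form; the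
restriction of a polarization to an abelian subvariety). [cite: VoisinHodgeI2002, §7.3.1] [cite: Lange2023AbelianVarietiesComplex, §2.1.1 Cor. 2.1.4]
[cite: ClemensGriffiths1972, §3 Def. 3.5 (p. 293)] -/
theorem _root_.Literature.AlgebraicGeometry.Motives.HodgeStructure.Hom.isRiemannForm_smul_weilTwoForm_comap
    (φ : H.Hom H') (hφ : Function.Injective φ.toLinearMap)
    (hA : LinearMap.toMatrix b b' φ.toLinearMap = A.map (Int.cast : ℤ → ℚ)) (Q : H'.Polarization) {c : ℝ}
    (hi : Function.Injective (mapMatrix (weilMinusCPeriod H hn b) (weilMinusCPeriod H' hn b') A))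
    (hR : IsRiemannForm (weilMinusCPeriod H' hn b') (c • Q.weilTwoForm b' hn)) :
    IsRiemannForm (weilMinusCPeriod H hn b) (c • (Q.comap φ hφ).weilTwoForm b hn) := by
  have hF : ∀ x, weilMinusCPeriod H' hn b' (A.map (Int.cast : ℤ → ℝ) *ᵥ x) =
      analyticRep (weilMinusCPeriod H hn b) (weilMinusCPeriod H' hn b') (A.map (Int.cast : ℤ → ℝ))
        (φ.map_intCast_mul_jMatrix_weilMinusCPeriod H H' hn b b' hA) (weilMinusCPeriod H hn b x) :=
    fun x ↦ by rw [analyticRep_apply]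
  rw [← φ.pullbackForm_analyticRep_weilTwoForm H H' hn b b' hφ hA Q c]
  exact hR.pullback (weilMinusCPeriod H hn b) (weilMinusCPeriod H' hn b') hF
    (analyticRep_injective_of_mapMatrix_injective (weilMinusCPeriod H hn b) (weilMinusCPeriod H' hn b') hF hi)

end Functor

/-! ## §2 Through a splitting `φ : H₀ ≅ H₁ ⊕ H₂`: the factors are polarized direct factors -/

section Splitting

variable {n : ℤ} (H₁ : HodgeStructure V n) (H₂ : HodgeStructure W n) (H₀ : HodgeStructure V₀ n) (hn : Odd n)
  [Module.Finite ℚ V] [Module.Finite ℚ W] [Module.Finite ℚ V₀] {ι₁ ι₂ ι₀ : Type*} [Fintype ι₁] [Fintype ι₂]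
  [Fintype ι₀] [DecidableEq ι₁] [DecidableEq ι₂] [DecidableEq ι₀] (b₁ : Basis ι₁ ℚ V) (b₂ : Basis ι₂ ℚ W)
  (b₀ : Basis ι₀ ℚ V₀) {A : Matrix (ι₁ ⊕ ι₂) ι₀ ℤ} {B : Matrix ι₀ (ι₁ ⊕ ι₂) ℤ}
  (φ : H₀.Hom (H₁.prod H₂)) (hφ : Function.Injective φ.toLinearMap)
  (hA : LinearMap.toMatrix b₀ (b₁.prod b₂) φ.toLinearMap = A.map (Int.cast : ℤ → ℚ))
  (hBA : B * A = 1) (hAB : A * B = 1) (Q₁ : H₁.Polarization) (Q₂ : H₂.Polarization)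

include hA hBA in
omit [Module.Finite ℚ V] [Module.Finite ℚ W] [Module.Finite ℚ V₀] in
/-- A morphism whose integer matrix has a left integer inverse is injective (so that `φ^*Q` is defined).
[cite: Lange2023AbelianVarietiesComplex, §1.1.2 Prop. 1.1.6] -/
theorem _root_.Literature.AlgebraicGeometry.Motives.HodgeStructure.Hom.toLinearMap_injective_of_inverse :
    Function.Injective φ.toLinearMap := by
  have hcomp : (Matrix.toLin (b₁.prod b₂) b₀ (B.map (Int.cast : ℤ → ℚ))).comp φ.toLinearMap = LinearMap.id := by
    rw [← Matrix.toLin_toMatrix b₀ (b₁.prod b₂) φ.toLinearMap, hA, ← Matrix.toLin_mul, ← wP_map_intCast_mul_rat,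
      hBA, Matrix.map_one Int.cast Int.cast_zero Int.cast_one, Matrix.toLin_one]
  exact Function.LeftInverse.injective (g := Matrix.toLin (b₁.prod b₂) b₀ (B.map (Int.cast : ℤ → ℚ)))
    fun x ↦ by rw [← LinearMap.comp_apply, hcomp, LinearMap.id_apply]

include hAB in
omit [DecidableEq ι₀] in
/-- `A (B (1; 0)) = (1; 0)` over `ℝ`. Private plumbing. [folklore] -/
private theorem wP_mulVec_factorInl (x : ι₁ → ℝ) :
    A.map (Int.cast : ℤ → ℝ) *ᵥ
        ((B * Matrix.fromRows (1 : Matrix ι₁ ι₁ ℤ) (0 : Matrix ι₂ ι₁ ℤ)).map (Int.cast : ℤ → ℝ) *ᵥ x) =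
      Sum.elim x (0 : ι₂ → ℝ) := by
  rw [Matrix.mulVec_mulVec, ← wP_map_intCast_mul, ← Matrix.mul_assoc, hAB, Matrix.one_mul,
    wP_fromRows_one_zero_mulVec]

include hAB in
omit [DecidableEq ι₀] in
/-- `A (B (0; 1)) = (0; 1)` over `ℝ`. Private plumbing. [folklore] -/
private theorem wP_mulVec_factorInr (y : ι₂ → ℝ) :
    A.map (Int.cast : ℤ → ℝ) *ᵥ
        ((B * Matrix.fromRows (0 : Matrix ι₁ ι₂ ℤ) (1 : Matrix ι₂ ι₂ ℤ)).map (Int.cast : ℤ → ℝ) *ᵥ y) =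
      Sum.elim (0 : ι₁ → ℝ) y := by
  rw [Matrix.mulVec_mulVec, ← wP_map_intCast_mul, ← Matrix.mul_assoc, hAB, Matrix.one_mul,
    wP_fromRows_zero_one_mulVec]

include hA hAB in
omit [Module.Finite ℚ V] [Module.Finite ℚ W] [Module.Finite ℚ V₀] in
/-- **`A_{Q₀}(B(1;0) x, B(1;0) y) = A_{Q₁}(x, y)`** for `Q₀ = φ^*(Q₁ ⊕ Q₂)`: along the inclusion of the first
factor, Lange's form of `Q₀` restricts to that of `Q₁` ("`(ℋ_C)_{φ_*} = ℋ_{V₁}` restricted").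
[cite: ClemensGriffiths1972, §3 (3.6) and proof of Lemma 3.11 (pp. 293–294)] [cite: Lange2023AbelianVarietiesComplex, §5.4.1 (5.24)] -/
theorem weilCoordForm_comap_prod_factorInl (x y : ι₁ → ℝ) :
    ((Q₁.prod Q₂).comap φ hφ).weilCoordForm b₀
        ((B * Matrix.fromRows (1 : Matrix ι₁ ι₁ ℤ) (0 : Matrix ι₂ ι₁ ℤ)).map (Int.cast : ℤ → ℝ) *ᵥ x)
        ((B * Matrix.fromRows (1 : Matrix ι₁ ι₁ ℤ) (0 : Matrix ι₂ ι₁ ℤ)).map (Int.cast : ℤ → ℝ) *ᵥ y) =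
      Q₁.weilCoordForm b₁ x y := by
  rw [φ.weilCoordForm_comap H₀ (H₁.prod H₂) b₀ (b₁.prod b₂) hφ hA, wP_mulVec_factorInl hAB,
    wP_mulVec_factorInl hAB, weilCoordForm_polarizationProd]
  have h1 : (fun i ↦ Sum.elim x (0 : ι₂ → ℝ) (Sum.inl i)) = x := rfl
  have h1' : (fun i ↦ Sum.elim y (0 : ι₂ → ℝ) (Sum.inl i)) = y := rfl
  have h2 : (fun j ↦ Sum.elim x (0 : ι₂ → ℝ) (Sum.inr j)) = 0 := rfl
  rw [h1, h1', h2, LinearMap.map_zero₂, add_zero]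

include hA hAB in
omit [Module.Finite ℚ V] [Module.Finite ℚ W] [Module.Finite ℚ V₀] in
/-- **`A_{Q₀}(B(0;1) x, B(0;1) y) = A_{Q₂}(x, y)`** for `Q₀ = φ^*(Q₁ ⊕ Q₂)`.
[cite: ClemensGriffiths1972, §3 (3.6) and proof of Lemma 3.11 (pp. 293–294)] [cite: Lange2023AbelianVarietiesComplex, §5.4.1 (5.24)] -/
theorem weilCoordForm_comap_prod_factorInr (x y : ι₂ → ℝ) :
    ((Q₁.prod Q₂).comap φ hφ).weilCoordForm b₀
        ((B * Matrix.fromRows (0 : Matrix ι₁ ι₂ ℤ) (1 : Matrix ι₂ ι₂ ℤ)).map (Int.cast : ℤ → ℝ) *ᵥ x)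
        ((B * Matrix.fromRows (0 : Matrix ι₁ ι₂ ℤ) (1 : Matrix ι₂ ι₂ ℤ)).map (Int.cast : ℤ → ℝ) *ᵥ y) =
      Q₂.weilCoordForm b₂ x y := by
  rw [φ.weilCoordForm_comap H₀ (H₁.prod H₂) b₀ (b₁.prod b₂) hφ hA, wP_mulVec_factorInr hAB,
    wP_mulVec_factorInr hAB, weilCoordForm_polarizationProd]
  have h1 : (fun i ↦ Sum.elim (0 : ι₁ → ℝ) x (Sum.inl i)) = 0 := rfl
  have h2 : (fun j ↦ Sum.elim (0 : ι₁ → ℝ) x (Sum.inr j)) = x := rfl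
  have h2' : (fun j ↦ Sum.elim (0 : ι₁ → ℝ) y (Sum.inr j)) = y := rfl
  rw [h1, h2, h2', LinearMap.map_zero₂, zero_add]

include hA hBA hAB

/-- **`(B(1;0))_ℝ` intertwines the Weil complex structures of `J_W(H₁, Λ₁)` and `J_W(H₀, Λ₀)`** (the inclusion
of the first factor through `φ` has a `ℂ`-linear analytic representation).
[cite: Lange2023AbelianVarietiesComplex, §1.1.2 Prop. 1.1.6] [cite: ClemensGriffiths1972, §3 proof of Lemma 3.11 (p. 294)] -/
theorem _root_.Literature.AlgebraicGeometry.Motives.HodgeStructure.Hom.map_intCast_factorInl_mul_jMatrix_weilMinusCPeriod :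
    (B * Matrix.fromRows (1 : Matrix ι₁ ι₁ ℤ) (0 : Matrix ι₂ ι₁ ℤ)).map (Int.cast : ℤ → ℝ) *
        jMatrix (weilMinusCPeriod H₁ hn b₁) =
      jMatrix (weilMinusCPeriod H₀ hn b₀) *
        (B * Matrix.fromRows (1 : Matrix ι₁ ι₁ ℤ) (0 : Matrix ι₂ ι₁ ℤ)).map (Int.cast : ℤ → ℝ) := by
  have hinl := Hom.map_intCast_mul_jMatrix_weilMinusCPeriod H₁ (H₁.prod H₂) hn b₁ (b₁.prod b₂)
    (⟨LinearMap.inl ℚ V W, map_inl_baseChange_F_le H₁ H₂⟩ : H₁.Hom (H₁.prod H₂)) (toMatrix_prod_inl b₁ b₂)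
  have hB := φ.map_intCast_inverse_mul_jMatrix_weilMinusCPeriod H₁ H₂ H₀ hn b₁ b₂ b₀ hA hBA hAB
  rw [wP_map_intCast_mul, Matrix.mul_assoc, hinl, ← Matrix.mul_assoc, hB, Matrix.mul_assoc]

/-- **`(B(0;1))_ℝ` intertwines the Weil complex structures of `J_W(H₂, Λ₂)` and `J_W(H₀, Λ₀)`.**
[cite: Lange2023AbelianVarietiesComplex, §1.1.2 Prop. 1.1.6] [cite: ClemensGriffiths1972, §3 proof of Lemma 3.11 (p. 294)] -/
theorem _root_.Literature.AlgebraicGeometry.Motives.HodgeStructure.Hom.map_intCast_factorInr_mul_jMatrix_weilMinusCPeriod :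
    (B * Matrix.fromRows (0 : Matrix ι₁ ι₂ ℤ) (1 : Matrix ι₂ ι₂ ℤ)).map (Int.cast : ℤ → ℝ) *
        jMatrix (weilMinusCPeriod H₂ hn b₂) =
      jMatrix (weilMinusCPeriod H₀ hn b₀) *
        (B * Matrix.fromRows (0 : Matrix ι₁ ι₂ ℤ) (1 : Matrix ι₂ ι₂ ℤ)).map (Int.cast : ℤ → ℝ) := by
  have hinr := Hom.map_intCast_mul_jMatrix_weilMinusCPeriod H₂ (H₁.prod H₂) hn b₂ (b₁.prod b₂)
    (⟨LinearMap.inr ℚ V W, map_inr_baseChange_F_le H₁ H₂⟩ : H₂.Hom (H₁.prod H₂)) (toMatrix_prod_inr b₁ b₂)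
  have hB := φ.map_intCast_inverse_mul_jMatrix_weilMinusCPeriod H₁ H₂ H₀ hn b₁ b₂ b₀ hA hBA hAB
  rw [wP_map_intCast_mul, Matrix.mul_assoc, hinr, ← Matrix.mul_assoc, hB, Matrix.mul_assoc]

/-- **`ρ(B(1;0))^*(c·A_{Q₀}) = c·A_{Q₁}`** (`Q₀ = φ^*(Q₁ ⊕ Q₂)`): the inclusion `J_W(H₁, Λ₁) → J_W(H₀, Λ₀)` of the
first factor through `φ` is a morphism of polarized tori for Lange's forms of `Q₁` and `Q₀`.
[cite: ClemensGriffiths1972, §3 Def. 3.5, (3.6), Lemma 3.11 (pp. 293–294)] [cite: Lange2023AbelianVarietiesComplex, §5.4.3 Prop. 5.4.11] -/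
theorem pullbackForm_analyticRep_factorInl_weilTwoForm (c : ℝ) :
    pullbackForm
        (analyticRep (weilMinusCPeriod H₁ hn b₁) (weilMinusCPeriod H₀ hn b₀)
          ((B * Matrix.fromRows (1 : Matrix ι₁ ι₁ ℤ) (0 : Matrix ι₂ ι₁ ℤ)).map (Int.cast : ℤ → ℝ))
          (φ.map_intCast_factorInl_mul_jMatrix_weilMinusCPeriod H₁ H₂ H₀ hn b₁ b₂ b₀ hA hBA hAB))
        (c • ((Q₁.prod Q₂).comap φ hφ).weilTwoForm b₀ hn) =
      c • Q₁.weilTwoForm b₁ hn := by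
  ext v
  obtain ⟨x, hx⟩ := (weilMinusCPeriod H₁ hn b₁).surjective (v 0)
  obtain ⟨y, hy⟩ := (weilMinusCPeriod H₁ hn b₁).surjective (v 1)
  rw [wP_eq_vecCons_two v, ← hx, ← hy, pullbackForm_apply, analyticRep_apply, analyticRep_apply,
    ContinuousAlternatingMap.smul_apply, ContinuousAlternatingMap.smul_apply, Polarization.weilTwoForm_apply_apply,
    Polarization.weilTwoForm_apply_apply, weilCoordForm_comap_prod_factorInl H₁ H₂ H₀ b₁ b₂ b₀ φ hφ hA hAB Q₁ Q₂]

/-- **`ρ(B(0;1))^*(c·A_{Q₀}) = c·A_{Q₂}`** (`Q₀ = φ^*(Q₁ ⊕ Q₂)`).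
[cite: ClemensGriffiths1972, §3 Def. 3.5, (3.6), Lemma 3.11 (pp. 293–294)] [cite: Lange2023AbelianVarietiesComplex, §5.4.3 Prop. 5.4.11] -/
theorem pullbackForm_analyticRep_factorInr_weilTwoForm (c : ℝ) :
    pullbackForm
        (analyticRep (weilMinusCPeriod H₂ hn b₂) (weilMinusCPeriod H₀ hn b₀)
          ((B * Matrix.fromRows (0 : Matrix ι₁ ι₂ ℤ) (1 : Matrix ι₂ ι₂ ℤ)).map (Int.cast : ℤ → ℝ))
          (φ.map_intCast_factorInr_mul_jMatrix_weilMinusCPeriod H₁ H₂ H₀ hn b₁ b₂ b₀ hA hBA hAB))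
        (c • ((Q₁.prod Q₂).comap φ hφ).weilTwoForm b₀ hn) =
      c • Q₂.weilTwoForm b₂ hn := by
  ext v
  obtain ⟨x, hx⟩ := (weilMinusCPeriod H₂ hn b₂).surjective (v 0)
  obtain ⟨y, hy⟩ := (weilMinusCPeriod H₂ hn b₂).surjective (v 1)
  rw [wP_eq_vecCons_two v, ← hx, ← hy, pullbackForm_apply, analyticRep_apply, analyticRep_apply,
    ContinuousAlternatingMap.smul_apply, ContinuousAlternatingMap.smul_apply, Polarization.weilTwoForm_apply_apply,
    Polarization.weilTwoForm_apply_apply, weilCoordForm_comap_prod_factorInr H₁ H₂ H₀ b₁ b₂ b₀ φ hφ hA hAB Q₁ Q₂]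

-- `IsRiemannForm.pullback` / `analyticRep_injective_of_mapMatrix_injective` applied to the period isomorphisms
-- `weilMinusCPeriod` unify deeply nested coercions: raise the recursion limit (elaboration stays fast).
set_option maxRecDepth 8192 in
/-- **Clemens–Griffiths Lemma 3.11 / (3.10) through `φ`, with the polarizations: the factors are POLARIZED direct
factors.** For an isomorphism of integral Hodge structures `φ : H₀ ≅ H₁ ⊕ H₂` of odd weight (integer matrix `A`,
two-sided integer inverse `B`) and polarizations `Q₁`, `Q₂`, polarize `H₀` by `Q₀ = φ^*(Q₁ ⊕ Q₂)`. Then there is ONE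
positive integer `N` such that `N·A_{Q₀}` is a Riemann form of `J_W(H₀, Λ₀)`, `N·A_{Q₁}`, `N·A_{Q₂}` are Riemann
forms of `J_W(H₁, Λ₁)`, `J_W(H₂, Λ₂)`, and the analytic representations of the (holomorphic, injective, split)
inclusions `ρ(B(1;0))`, `ρ(B(0;1))` pull `N·A_{Q₀}` back to `N·A_{Q₁}`, `N·A_{Q₂}` — "`𝒥(V₁) ≅ 𝒥(V₂) ⊕ 𝒥(C)`" as
polarized tori, "`(ℋ_C)_{φ_*} = ℋ_{V₁}` restricted". [cite: ClemensGriffiths1972, §3 Def. 3.5, (3.6), (3.10), Lemma 3.11 (pp. 293–294)]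
[cite: Lange2023AbelianVarietiesComplex, §5.4.3 Prop. 5.4.11, §2.1.1 Cor. 2.1.4] -/
theorem clemensGriffiths_3_11_weilJacobian :
    ∃ N : ℕ, 0 < N ∧
      IsRiemannForm (weilMinusCPeriod H₀ hn b₀) ((N : ℝ) • ((Q₁.prod Q₂).comap φ hφ).weilTwoForm b₀ hn) ∧
      IsRiemannForm (weilMinusCPeriod H₁ hn b₁) ((N : ℝ) • Q₁.weilTwoForm b₁ hn) ∧
      IsRiemannForm (weilMinusCPeriod H₂ hn b₂) ((N : ℝ) • Q₂.weilTwoForm b₂ hn) ∧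
      pullbackForm
          (analyticRep (weilMinusCPeriod H₁ hn b₁) (weilMinusCPeriod H₀ hn b₀)
            ((B * Matrix.fromRows (1 : Matrix ι₁ ι₁ ℤ) (0 : Matrix ι₂ ι₁ ℤ)).map (Int.cast : ℤ → ℝ))
            (φ.map_intCast_factorInl_mul_jMatrix_weilMinusCPeriod H₁ H₂ H₀ hn b₁ b₂ b₀ hA hBA hAB))
          ((N : ℝ) • ((Q₁.prod Q₂).comap φ hφ).weilTwoForm b₀ hn) = (N : ℝ) • Q₁.weilTwoForm b₁ hn ∧
      pullbackForm
          (analyticRep (weilMinusCPeriod H₂ hn b₂) (weilMinusCPeriod H₀ hn b₀)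
            ((B * Matrix.fromRows (0 : Matrix ι₁ ι₂ ℤ) (1 : Matrix ι₂ ι₂ ℤ)).map (Int.cast : ℤ → ℝ))
            (φ.map_intCast_factorInr_mul_jMatrix_weilMinusCPeriod H₁ H₂ H₀ hn b₁ b₂ b₀ hA hBA hAB))
          ((N : ℝ) • ((Q₁.prod Q₂).comap φ hφ).weilTwoForm b₀ hn) = (N : ℝ) • Q₂.weilTwoForm b₂ hn := by
  obtain ⟨N, hN, hR⟩ := ((Q₁.prod Q₂).comap φ hφ).exists_isRiemannForm_smul_weilTwoForm b₀ hn
  have h₁ := pullbackForm_analyticRep_factorInl_weilTwoForm H₁ H₂ H₀ hn b₁ b₂ b₀ φ hφ hA hBA hAB Q₁ Q₂ (N : ℝ)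
  have h₂ := pullbackForm_analyticRep_factorInr_weilTwoForm H₁ H₂ H₀ hn b₁ b₂ b₀ φ hφ hA hBA hAB Q₁ Q₂ (N : ℝ)
  have hF₁ : ∀ x, weilMinusCPeriod H₀ hn b₀
        ((B * Matrix.fromRows (1 : Matrix ι₁ ι₁ ℤ) (0 : Matrix ι₂ ι₁ ℤ)).map (Int.cast : ℤ → ℝ) *ᵥ x) =
      analyticRep (weilMinusCPeriod H₁ hn b₁) (weilMinusCPeriod H₀ hn b₀)
        ((B * Matrix.fromRows (1 : Matrix ι₁ ι₁ ℤ) (0 : Matrix ι₂ ι₁ ℤ)).map (Int.cast : ℤ → ℝ))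
        (φ.map_intCast_factorInl_mul_jMatrix_weilMinusCPeriod H₁ H₂ H₀ hn b₁ b₂ b₀ hA hBA hAB)
        (weilMinusCPeriod H₁ hn b₁ x) :=
    fun x ↦ by rw [analyticRep_apply]
  have hF₂ : ∀ x, weilMinusCPeriod H₀ hn b₀
        ((B * Matrix.fromRows (0 : Matrix ι₁ ι₂ ℤ) (1 : Matrix ι₂ ι₂ ℤ)).map (Int.cast : ℤ → ℝ) *ᵥ x) =
      analyticRep (weilMinusCPeriod H₂ hn b₂) (weilMinusCPeriod H₀ hn b₀)
        ((B * Matrix.fromRows (0 : Matrix ι₁ ι₂ ℤ) (1 : Matrix ι₂ ι₂ ℤ)).map (Int.cast : ℤ → ℝ))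
        (φ.map_intCast_factorInr_mul_jMatrix_weilMinusCPeriod H₁ H₂ H₀ hn b₁ b₂ b₀ hA hBA hAB)
        (weilMinusCPeriod H₂ hn b₂ x) :=
    fun x ↦ by rw [analyticRep_apply]
  refine ⟨N, hN, hR, ?_, ?_, h₁, h₂⟩
  · rw [← h₁]
    exact hR.pullback (weilMinusCPeriod H₁ hn b₁) (weilMinusCPeriod H₀ hn b₀) hF₁
      (analyticRep_injective_of_mapMatrix_injective (weilMinusCPeriod H₁ hn b₁) (weilMinusCPeriod H₀ hn b₀) hF₁
        (ComplexTorus.mapMatrix_factorInl_injective hAB))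
  · rw [← h₂]
    exact hR.pullback (weilMinusCPeriod H₂ hn b₂) (weilMinusCPeriod H₀ hn b₀) hF₂
      (analyticRep_injective_of_mapMatrix_injective (weilMinusCPeriod H₂ hn b₂) (weilMinusCPeriod H₀ hn b₀) hF₂
        (ComplexTorus.mapMatrix_factorInr_injective hAB))

end Splitting

/-! ## §3 The twisted summand: `J_W(L, Λ_L)` with `A_{Q_L}` is a polarized direct factor of `J_W(H′, Λ′)` -/

section Twisted

variable {V' : Type w} [AddCommGroup V'] [Module ℚ V'] {k m : ℤ}
  (HX : HodgeStructure V k) (L : HodgeStructure W m) (r : ℤ) (hk : m - 2 * r = k) (hk' : Odd k) (hm : Odd m)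
  [Module.Finite ℚ V] [Module.Finite ℚ W] [Module.Finite ℚ V'] {ι κ ι' : Type*} [Fintype ι] [Fintype κ]
  [Fintype ι'] [DecidableEq ι] [DecidableEq κ] [DecidableEq ι'] (b : Basis ι ℚ V) (c : Basis κ ℚ W)
  (HX' : HodgeStructure V' k) (b' : Basis ι' ℚ V') {A : Matrix (ι ⊕ κ) ι' ℤ} {B : Matrix ι' (ι ⊕ κ) ℤ}
  (φ : HX'.Hom (HX.prod ((L.tateTwist r).cast hk))) (hφ : Function.Injective φ.toLinearMap)
  (hA : LinearMap.toMatrix b' (b.prod c) φ.toLinearMap = A.map (Int.cast : ℤ → ℚ)) (hBA : B * A = 1)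
  (hAB : A * B = 1) (QX : HX.Polarization) (QL : L.Polarization)

omit [Module.Finite ℚ W] [DecidableEq κ] in
/-- The twisted, weight-transported polarization `(Q_L(r)).cast hk` has the same real form `A` as `Q_L` (same
bilinear form). [cite: Lange2023AbelianVarietiesComplex, §5.4.1 (5.24)] -/
theorem weilCoordForm_tateTwist_cast : ((QL.tateTwist r).cast hk).weilCoordForm c = QL.weilCoordForm c :=
  Polarization.weilCoordForm_congr c _ _ rfl

include hA hBA hAB

/-- **`(B(0;1))_ℝ` intertwines the Weil complex structures of `J_W(L, Λ_L)` and `J_W(H′, Λ′)`** (`-C` of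
`L(r)⟨hk⟩` is `-C` of `L`). [cite: Lange2023AbelianVarietiesComplex, §1.1.2 Prop. 1.1.6, §5.4.3 Prop. 5.4.12]
[cite: ClemensGriffiths1972, §3 proof of Lemma 3.11 (p. 294)] -/
theorem _root_.Literature.AlgebraicGeometry.Motives.HodgeStructure.Hom.map_intCast_twistedFactorInr_mul_jMatrix_weilMinusCPeriod :
    (B * Matrix.fromRows (0 : Matrix ι κ ℤ) (1 : Matrix κ κ ℤ)).map (Int.cast : ℤ → ℝ) *
        jMatrix (weilMinusCPeriod L hm c) =
      jMatrix (weilMinusCPeriod HX' hk' b') *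
        (B * Matrix.fromRows (0 : Matrix ι κ ℤ) (1 : Matrix κ κ ℤ)).map (Int.cast : ℤ → ℝ) := by
  rw [← jMatrix_weilMinusCPeriod_tateTwist_cast L r hk hk' hm c]
  exact φ.map_intCast_factorInr_mul_jMatrix_weilMinusCPeriod HX ((L.tateTwist r).cast hk) HX' hk' b c b' hA
    hBA hAB

/-- **`ρ(B(0;1))^*(c′·A_{Q′}) = c′·A_{Q_L}` on `J_W(L, Λ_L)`**, `Q′ = φ^*(Q_H ⊕ Q_L(r)⟨hk⟩)`: the inclusion of the
twisted summand's Weil Jacobian is a morphism of polarized tori for `A_{Q_L}` and `A_{Q′}` ("`(ℋ_C)_{φ_*} = ℋ_{V₁}`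
restricted"). [cite: ClemensGriffiths1972, §3 Def. 3.5, Lemma 3.11 and proof (pp. 293–294)] [cite: Lange2023AbelianVarietiesComplex, §5.4.3 Prop. 5.4.11] -/
theorem pullbackForm_analyticRep_twistedFactorInr_weilTwoForm (c' : ℝ) :
    pullbackForm
        (analyticRep (weilMinusCPeriod L hm c) (weilMinusCPeriod HX' hk' b')
          ((B * Matrix.fromRows (0 : Matrix ι κ ℤ) (1 : Matrix κ κ ℤ)).map (Int.cast : ℤ → ℝ))
          (φ.map_intCast_twistedFactorInr_mul_jMatrix_weilMinusCPeriod HX L r hk hk' hm b c HX' b' hA hBA hAB))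
        (c' • ((QX.prod ((QL.tateTwist r).cast hk)).comap φ hφ).weilTwoForm b' hk') =
      c' • QL.weilTwoForm c hm := by
  ext v
  obtain ⟨x, hx⟩ := (weilMinusCPeriod L hm c).surjective (v 0)
  obtain ⟨y, hy⟩ := (weilMinusCPeriod L hm c).surjective (v 1)
  rw [wP_eq_vecCons_two v, ← hx, ← hy, pullbackForm_apply, analyticRep_apply, analyticRep_apply,
    ContinuousAlternatingMap.smul_apply, ContinuousAlternatingMap.smul_apply, Polarization.weilTwoForm_apply_apply,
    Polarization.weilTwoForm_apply_apply,
    weilCoordForm_comap_prod_factorInr HX ((L.tateTwist r).cast hk) HX' b c b' φ hφ hA hAB QX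
      ((QL.tateTwist r).cast hk), weilCoordForm_tateTwist_cast]

-- `IsRiemannForm.pullback` / `analyticRep_injective_of_mapMatrix_injective` applied to the period isomorphisms
-- `weilMinusCPeriod` unify deeply nested coercions: raise the recursion limit (elaboration stays fast).
set_option maxRecDepth 8192 in
/-- **Clemens–Griffiths Lemma 3.11 with the polarization, twisted summand** («`𝒥(V₁) ≅ 𝒥(V₂) ⊕ 𝒥(C)`» and
«`(ℋ_C)_{φ_*} = ℋ_{V₁}|`»): for an isomorphism of integral Hodge structures `φ : H′ ≅ H ⊕ L(r)` of odd weights and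
polarizations `Q_H`, `Q_L`, with `Q′ = φ^*(Q_H ⊕ Q_L(r))`, there is ONE positive integer `N` with `N·A_{Q′}` a Riemann
form of `J_W(H′, Λ′)`, `N·A_{Q_L}` a Riemann form of `J_W(L, Λ_L)`, and `ρ(B(0;1))^*(N·A_{Q′}) = N·A_{Q_L}` — the
twisted summand's Weil Jacobian with its own polarization is a polarized direct factor.
[cite: ClemensGriffiths1972, §3 Def. 3.5, (3.6), Lemma 3.11 (pp. 293–294)] [cite: Lange2023AbelianVarietiesComplex, §5.4.3 Prop. 5.4.11, §2.1.1 Cor. 2.1.4] -/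
theorem clemensGriffiths_3_11_weilJacobian_twisted :
    ∃ N : ℕ, 0 < N ∧
      IsRiemannForm (weilMinusCPeriod HX' hk' b')
        ((N : ℝ) • ((QX.prod ((QL.tateTwist r).cast hk)).comap φ hφ).weilTwoForm b' hk') ∧
      IsRiemannForm (weilMinusCPeriod L hm c) ((N : ℝ) • QL.weilTwoForm c hm) ∧
      pullbackForm
          (analyticRep (weilMinusCPeriod L hm c) (weilMinusCPeriod HX' hk' b')
            ((B * Matrix.fromRows (0 : Matrix ι κ ℤ) (1 : Matrix κ κ ℤ)).map (Int.cast : ℤ → ℝ))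
            (φ.map_intCast_twistedFactorInr_mul_jMatrix_weilMinusCPeriod HX L r hk hk' hm b c HX' b' hA hBA hAB))
          ((N : ℝ) • ((QX.prod ((QL.tateTwist r).cast hk)).comap φ hφ).weilTwoForm b' hk') =
        (N : ℝ) • QL.weilTwoForm c hm := by
  obtain ⟨N, hN, hR⟩ :=
    ((QX.prod ((QL.tateTwist r).cast hk)).comap φ hφ).exists_isRiemannForm_smul_weilTwoForm b' hk'
  have h := pullbackForm_analyticRep_twistedFactorInr_weilTwoForm HX L r hk hk' hm b c HX' b' φ hφ hA hBA hAB QX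
    QL (N : ℝ)
  have hF : ∀ x, weilMinusCPeriod HX' hk' b'
        ((B * Matrix.fromRows (0 : Matrix ι κ ℤ) (1 : Matrix κ κ ℤ)).map (Int.cast : ℤ → ℝ) *ᵥ x) =
      analyticRep (weilMinusCPeriod L hm c) (weilMinusCPeriod HX' hk' b')
        ((B * Matrix.fromRows (0 : Matrix ι κ ℤ) (1 : Matrix κ κ ℤ)).map (Int.cast : ℤ → ℝ))
        (φ.map_intCast_twistedFactorInr_mul_jMatrix_weilMinusCPeriod HX L r hk hk' hm b c HX' b' hA hBA hAB)
        (weilMinusCPeriod L hm c x) :=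
    fun x ↦ by rw [analyticRep_apply]
  refine ⟨N, hN, hR, ?_, h⟩
  rw [← h]
  exact hR.pullback (weilMinusCPeriod L hm c) (weilMinusCPeriod HX' hk' b') hF
    (analyticRep_injective_of_mapMatrix_injective (weilMinusCPeriod L hm c) (weilMinusCPeriod HX' hk' b') hF
      (ComplexTorus.mapMatrix_factorInr_injective hAB))

end Twisted

/-! ## §4 Blow-up numerology `(k, m, r) = (3, 1, -1)`: `(J(C), N·A_{Q_C})` is a polarized direct factor of
`(J_W(H³(X̃)), N·A_{Q′})` -/

section Blowup

variable {V' : Type w} [AddCommGroup V'] [Module ℚ V'] (HX : HodgeStructure V 3) (HC : HodgeStructure W 1)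
  (HX' : HodgeStructure V' 3) [Module.Finite ℚ V] [Module.Finite ℚ W] [Module.Finite ℚ V'] {ι κ ι' : Type*}
  [Fintype ι] [Fintype κ] [Fintype ι'] [DecidableEq ι] [DecidableEq κ] [DecidableEq ι'] (b : Basis ι ℚ V)
  (c : Basis κ ℚ W) (b' : Basis ι' ℚ V') {A : Matrix (ι ⊕ κ) ι' ℤ} {B : Matrix ι' (ι ⊕ κ) ℤ}
  (φ : HX'.Hom (HX.prod ((HC.tateTwist (-1)).cast (by norm_num)))) (hφ : Function.Injective φ.toLinearMap)
  (hA : LinearMap.toMatrix b' (b.prod c) φ.toLinearMap = A.map (Int.cast : ℤ → ℚ)) (hBA : B * A = 1)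
  (hAB : A * B = 1) (QX : HX.Polarization) (QC : HC.Polarization)

/-- `3` is odd. Private numerology. [folklore] -/
private theorem odd_three_wP : Odd (3 : ℤ) := ⟨1, by norm_num⟩

include hA hBA hAB

/-- **Voisin Ch. 12 Exercise 1 (a) with the polarizations (C–G Lemma 3.11 (ii))**: from an isomorphism of integral
Hodge structures `H³(X̃) ≅ H³(X) ⊕ H¹(C)(-1)` (Thm. 7.31) and polarizations `Q_X` of `H³(X)`, `Q_C` of `H¹(C)`,
polarize `H³(X̃)` by `Q′ = φ^*(Q_X ⊕ Q_C(-1))`; then for ONE `N ≥ 1`, `N·A_{Q′}` is a Riemann form of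
`J_W(H³(X̃))`, `N·A_{Q_C}` one of `J_W(H¹(C)) = J(C)`, and the inclusion `ρ(B(0;1)) : J(C) → J_W(H³(X̃))` pulls
`N·A_{Q′}` back to `N·A_{Q_C}` — `J(C)` with (a multiple of) its own polarization is a polarized direct factor.
[cite: VoisinHodgeI2002, Ch. 12 Exercise 1 (a) (PDF p. 258)] [cite: ClemensGriffiths1972, §3 Lemma 3.11 and proof (p. 294)] -/
theorem clemensGriffiths_3_11_weilJacobian_blowup :
    ∃ N : ℕ, 0 < N ∧
      IsRiemannForm (weilMinusCPeriod HX' odd_three_wP b')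
        ((N : ℝ) • ((QX.prod ((QC.tateTwist (-1)).cast (by norm_num))).comap φ hφ).weilTwoForm b' odd_three_wP) ∧
      IsRiemannForm (weilMinusCPeriod HC odd_one c) ((N : ℝ) • QC.weilTwoForm c odd_one) ∧
      pullbackForm
          (analyticRep (weilMinusCPeriod HC odd_one c) (weilMinusCPeriod HX' odd_three_wP b')
            ((B * Matrix.fromRows (0 : Matrix ι κ ℤ) (1 : Matrix κ κ ℤ)).map (Int.cast : ℤ → ℝ))
            (φ.map_intCast_twistedFactorInr_mul_jMatrix_weilMinusCPeriod HX HC (-1) (by norm_num) odd_three_wP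
              odd_one b c HX' b' hA hBA hAB))
          ((N : ℝ) • ((QX.prod ((QC.tateTwist (-1)).cast (by norm_num))).comap φ hφ).weilTwoForm b'
            odd_three_wP) =
        (N : ℝ) • QC.weilTwoForm c odd_one :=
  clemensGriffiths_3_11_weilJacobian_twisted HX HC (-1) (by norm_num) odd_three_wP odd_one b c HX' b' φ hφ hA hBA
    hAB QX QC

end Blowup

end Literature.AlgebraicGeometry.HodgeTheory

end
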